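import Summits.NavierStokesRegularity.NavierStokesRegularity.Theorems.LerayQuarterDissipationFiniteDissipationLiouvilleEnergyTrace
import Summits.NavierStokesRegularity.NavierStokesRegularity.Theorems.LerayQuarterDissipationFiniteDissipationLiouvilleEnergyRemainder
import HarnessLib

/-!
# Crux `FiniteDissipationLiouville` (stmt-NavierStokesRegularity-22144): THE TRACE OF THE CRITICAL
# ELEMENT IS ITS FINAL-DATUM PROFILE `u₀` ACROSS THE APEX, and `‖u₀‖²_{L²(B(0,ρ))} ≍ ρ` two-sided

Theorems file of route `LerayQuarterDissipation` (lead prover ns-lqd-lead g9; `--supports` the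
crux, line `birth`; completes the energy portrait `…EnergyFloor` / `…EnergyRemainder` /
`…EnergyTrace`). Navier–Stokes regularity is NOT proved by anything here; no summit is.

Lead g7 identified the distributional trace `T_W` of the critical element with the `C¹` profile
`u₀` only OFF the apex (test fields supported in `{‖x‖ > r}`: the rate `L₀(−t)/‖x‖³` is not
integrable at the origin). The finite-energy remainder of `…EnergyRemainder`
(`∫‖W(t) − u₀‖² ≤ M √(−t)`) removes the restriction:

* `abs_integral_inner_le_of_lintegral_sq_le` — Cauchy–Schwarz: a measurable field with
  `∫‖f‖² ≤ E` pairs with every test field, `|∫⟪f, ψ⟫| ≤ √E ‖ψ‖_{L²}`.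
* `tendsto_pairing_of_energy` — **the trace IS `u₀` for EVERY test field, across the apex**:
  `∫⟪W(t), ψ⟫ → ∫⟪u₀, ψ⟫` as `t → 0⁻`, at the rate `√(M) (−t)^{1/4} ‖ψ‖_{L²}` (strong `L²`
  convergence). So every trace clause of the skeleton (the `L³`, weighted, rotational and energy
  floors AT the apex, not only off it) is a statement about the function `u₀ ∈ L²_loc(ℝ³)`.
* `lintegral_ball_finalDatum_sq_le` — the envelope `‖u₀‖ ≤ A/‖x‖` gives the CEILING
  `∫_{B(0,ρ)} ‖u₀‖² ≤ 3|B₁| A² ρ` at every scale.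
* `finalDatum_energy_apex_of_minimal` — **for the CRITICAL ELEMENT the final datum `u₀` is the
  trace across the apex and satisfies the TWO-SIDED apex energy law
  `ε₀² ρ < ∫_{B(0,ρ)} ‖u₀‖² ≤ 3|B₁| A² ρ` at EVERY scale `ρ > 0`** (floor:
  `EnergyTrace.trace_energy_apex_floor_of_singular`, transferred to the function `u₀` by
  `tendsto_pairing_of_energy` and Cauchy–Schwarz on the ball). The homogeneous DSS data
  `a(x̂)/|x|` have `∫_{B_ρ}|u₀|² = ‖a‖²_{L²(S²)} ρ` exactly: the clause says the critical element's
  datum is pinned to this scaling from both sides, uniformly in the scale.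

HONEST FRAMING: portrait facts (constants by compactness); no scenario removed; no summit proved.

References: Koch–Nadirashvili–Seregin–Šverák, Acta Math. 203 (2009), §4; Bradshaw–Tsai 2017
(DSS data class); Lemarié-Rieusset 2016, Ch. 14.
-/

noncomputable section

-- the summit and its single sub-problem share the name (CONVENTIONS §1), as in every Theorems file
set_option linter.dupNamespace false

namespace Summit.NavierStokesRegularity.NavierStokesRegularity.Theorems.FiniteDissipationLiouville.EnergyTrace

open MeasureTheory Set Filter Topology Metric Function TopologicalSpace
open Literature.Analysis Literature.Analysis.FluidPDE
open Summit.NavierStokesRegularity.NavierStokesRegularity.Theorems.FiniteDissipationLiouville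
open Summit.NavierStokesRegularity.NavierStokesRegularity.Theorems.FiniteDissipationLiouville.Birth.Apex
open Summit.NavierStokesRegularity.NavierStokesRegularity.Theorems
open scoped ENNReal NNReal RealInnerProductSpace

variable {C : ℝ} {W : ℝ → EuclideanSpace ℝ (Fin 3) → EuclideanSpace ℝ (Fin 3)}

/-! ### Cauchy–Schwarz for pairings against test fields -/

/-- **Cauchy–Schwarz in energy terms.** A measurable field `f` on `ℝ³` with `∫ ‖f‖² ≤ E` pairs
integrably with every test field `ψ`, and `|∫⟪f, ψ⟫| ≤ √E ‖ψ‖_{L²}`. -/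
theorem abs_integral_inner_le_of_lintegral_sq_le
    {f ψ : EuclideanSpace ℝ (Fin 3) → EuclideanSpace ℝ (Fin 3)}
    (hf : AEStronglyMeasurable f (volume : Measure (EuclideanSpace ℝ (Fin 3)))) {E : ℝ} (hE0 : 0 ≤ E)
    (hE : ∫⁻ x, ‖f x‖ₑ ^ 2 ≤ ENNReal.ofReal E)
    (hψ : FunctionSpaces.IsTestFunctionOn (⊤ : Opens (EuclideanSpace ℝ (Fin 3))) ψ) :
    Integrable (fun x => ⟪f x, ψ x⟫) (volume : Measure (EuclideanSpace ℝ (Fin 3))) ∧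
      |∫ x, ⟪f x, ψ x⟫| ≤ Real.sqrt E * Real.sqrt (∫ x, ‖ψ x‖ ^ 2) := by
  have hcψ : Continuous ψ := hψ.contDiff.continuous
  have hψcs : HasCompactSupport ψ := hψ.hasCompactSupport
  have e2 : ENNReal.ofReal (2 : ℝ) = 2 := by norm_num
  -- `f ∈ L²`, `ψ ∈ L²`
  have hlt : ∫⁻ x, ‖f x‖ₑ ^ 2 < ⊤ := lt_of_le_of_lt hE ENNReal.ofReal_lt_top
  have hf2 : MemLp f 2 (volume : Measure (EuclideanSpace ℝ (Fin 3))) := by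
    refine ⟨hf, (eLpNorm_lt_top_iff_lintegral_rpow_enorm_lt_top two_ne_zero
      ENNReal.ofNat_ne_top).2 ?_⟩
    rw [ENNReal.toReal_ofNat]
    have e : (fun x => ‖f x‖ₑ ^ (2 : ℝ)) = fun x => ‖f x‖ₑ ^ 2 := by
      funext x; rw [show (2 : ℝ) = ((2 : ℕ) : ℝ) by norm_num, ENNReal.rpow_natCast]
    rw [e]; exact hlt
  have hψ2 : MemLp ψ 2 (volume : Measure (EuclideanSpace ℝ (Fin 3))) :=
    hcψ.memLp_of_hasCompactSupport hψcs
  -- integrability of `‖f‖ ‖ψ‖` and of the pairing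
  have hprod : Integrable (fun x => ‖f x‖ * ‖ψ x‖) (volume : Measure (EuclideanSpace ℝ (Fin 3))) :=
    hf2.norm.integrable_mul hψ2.norm
  have hint : Integrable (fun x => ⟪f x, ψ x⟫) (volume : Measure (EuclideanSpace ℝ (Fin 3))) :=
    hprod.mono' (hf.inner hcψ.aestronglyMeasurable)
      (Eventually.of_forall fun x => by
        rw [Real.norm_eq_abs]; exact abs_real_inner_le_norm (f x) (ψ x))
  refine ⟨hint, ?_⟩
  -- Hölder with exponents `2, 2`
  have hf2' : MemLp f (ENNReal.ofReal 2) (volume : Measure (EuclideanSpace ℝ (Fin 3))) := by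
    rw [e2]; exact hf2
  have hψ2' : MemLp ψ (ENNReal.ofReal 2) (volume : Measure (EuclideanSpace ℝ (Fin 3))) := by
    rw [e2]; exact hψ2
  have h3 := integral_mul_norm_le_Lp_mul_Lq (μ := volume) Real.HolderConjugate.two_two hf2' hψ2'
  have hpow2 : ∀ y : EuclideanSpace ℝ (Fin 3), ‖y‖ ^ (2 : ℝ) = ‖y‖ ^ (2 : ℕ) := fun y =>
    Real.rpow_two ‖y‖
  have hfac1 : ∫ a, ‖f a‖ ^ (2 : ℝ) ≤ E := by
    have e1 : ∫ a, ‖f a‖ ^ (2 : ℝ) = (∫⁻ a, ‖f a‖ₑ ^ 2).toReal := by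
      rw [integral_eq_lintegral_of_nonneg_ae (ae_of_all _ fun a => by positivity)
        ((hf.norm.aemeasurable.pow_const _).aestronglyMeasurable)]
      congr 1
      refine lintegral_congr fun a => ?_
      rw [hpow2, ENNReal.ofReal_pow (norm_nonneg _), ofReal_norm]
    rw [e1]
    exact ENNReal.toReal_le_of_le_ofReal hE0 hE
  have hfac2 : ∫ a, ‖ψ a‖ ^ (2 : ℝ) = ∫ x, ‖ψ x‖ ^ 2 :=
    integral_congr_ae (ae_of_all _ fun x => hpow2 (ψ x))
  have hI1 : 0 ≤ ∫ a, ‖f a‖ ^ (2 : ℝ) := integral_nonneg fun _ => by positivity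
  have hI2 : 0 ≤ ∫ x, ‖ψ x‖ ^ 2 := integral_nonneg fun _ => by positivity
  have h1 : |∫ x, ⟪f x, ψ x⟫| ≤ ∫ x, ‖f x‖ * ‖ψ x‖ := by
    rw [← Real.norm_eq_abs]
    refine (norm_integral_le_integral_norm _).trans (integral_mono hint.norm hprod fun x => ?_)
    exact norm_inner_le_norm (f x) (ψ x)
  calc |∫ x, ⟪f x, ψ x⟫| ≤ ∫ x, ‖f x‖ * ‖ψ x‖ := h1
    _ ≤ (∫ a, ‖f a‖ ^ (2 : ℝ)) ^ (1 / (2 : ℝ)) * (∫ a, ‖ψ a‖ ^ (2 : ℝ)) ^ (1 / (2 : ℝ)) := h3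
    _ ≤ E ^ (1 / (2 : ℝ)) * (∫ x, ‖ψ x‖ ^ 2) ^ (1 / (2 : ℝ)) := by
        rw [hfac2]
        exact mul_le_mul_of_nonneg_right (Real.rpow_le_rpow hI1 hfac1 (by norm_num))
          (Real.rpow_nonneg hI2 _)
    _ = Real.sqrt E * Real.sqrt (∫ x, ‖ψ x‖ ^ 2) := by
        rw [Real.sqrt_eq_rpow, Real.sqrt_eq_rpow]

/-! ### The trace is the final datum, across the apex -/

/-- **THE TRACE IS THE FINAL DATUM FOR EVERY TEST FIELD.** If `W` is a Type-I ancient mild field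
with a measurable final datum `u₀` and the finite-energy remainder `∫ ‖W(t) − u₀‖² ≤ M √(−t)`
(`…EnergyRemainder`), then for EVERY test field `ψ` — including those whose support contains the
apex — `∫⟪W(t), ψ⟫ → ∫⟪u₀, ψ⟫` as `t → 0⁻`. -/
theorem tendsto_pairing_of_energy (hW : IsTypeIAncientMild C W)
    {u₀ : EuclideanSpace ℝ (Fin 3) → EuclideanSpace ℝ (Fin 3)}
    (hu₀m : AEStronglyMeasurable u₀ (volume : Measure (EuclideanSpace ℝ (Fin 3)))) {M : ℝ}
    (hener : ∀ t : ℝ, t < 0 → ∫⁻ x, ‖W t x - u₀ x‖ₑ ^ 2 ≤ ENNReal.ofReal (M * Real.sqrt (-t)))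
    {ψ : EuclideanSpace ℝ (Fin 3) → EuclideanSpace ℝ (Fin 3)}
    (hψ : FunctionSpaces.IsTestFunctionOn (⊤ : Opens (EuclideanSpace ℝ (Fin 3))) ψ) :
    Tendsto (fun t => ∫ x, ⟪W t x, ψ x⟫) (𝓝[<] 0) (𝓝 (∫ x, ⟪u₀ x, ψ x⟫)) := by
  have hcψ : Continuous ψ := hψ.contDiff.continuous
  have hψcs : HasCompactSupport ψ := hψ.hasCompactSupport
  set I : ℝ := Real.sqrt (∫ x, ‖ψ x‖ ^ 2) with hI
  -- the energy bound with a nonnegative constant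
  set M' : ℝ := max M 0 with hM'
  have hM'0 : 0 ≤ M' := le_max_right _ _
  have hener' : ∀ t : ℝ, t < 0 →
      ∫⁻ x, ‖W t x - u₀ x‖ₑ ^ 2 ≤ ENNReal.ofReal (M' * Real.sqrt (-t)) := fun t ht =>
    (hener t ht).trans (ENNReal.ofReal_le_ofReal
      (mul_le_mul_of_nonneg_right (le_max_left _ _) (Real.sqrt_nonneg _)))
  -- the estimate `|∫⟪W t, ψ⟫ − ∫⟪u₀, ψ⟫| ≤ √(M' √(−t)) · I` for `t < 0`
  have hest : ∀ t : ℝ, t < 0 →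
      ‖(∫ x, ⟪W t x, ψ x⟫) - ∫ x, ⟪u₀ x, ψ x⟫‖ ≤ Real.sqrt (M' * Real.sqrt (-t)) * I := by
    intro t ht
    have hmeas : AEStronglyMeasurable (fun x => W t x - u₀ x)
        (volume : Measure (EuclideanSpace ℝ (Fin 3))) :=
      (hW.continuous_slice ht).aestronglyMeasurable.sub hu₀m
    obtain ⟨hintd, hbd⟩ := abs_integral_inner_le_of_lintegral_sq_le hmeas
      (by positivity : 0 ≤ M' * Real.sqrt (-t)) (hener' t ht) hψ
    have hintW : Integrable (fun x => ⟪W t x, ψ x⟫) (volume : Measure (EuclideanSpace ℝ (Fin 3))) :=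
      integrable_inner_of_continuous_of_hasCompactSupport (hW.continuous_slice ht) hcψ hψcs
    -- `⟪u₀, ψ⟫ = ⟪W t, ψ⟫ − ⟪W t − u₀, ψ⟫` is integrable
    have hintu : Integrable (fun x => ⟪u₀ x, ψ x⟫) (volume : Measure (EuclideanSpace ℝ (Fin 3))) := by
      have e : (fun x => ⟪u₀ x, ψ x⟫) = fun x => ⟪W t x, ψ x⟫ - ⟪W t x - u₀ x, ψ x⟫ := by
        funext x; rw [inner_sub_left]; ring
      rw [e]; exact hintW.sub hintd
    have e2 : (∫ x, ⟪W t x, ψ x⟫) - ∫ x, ⟪u₀ x, ψ x⟫ = ∫ x, ⟪W t x - u₀ x, ψ x⟫ := by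
      rw [← integral_sub hintW hintu]
      refine integral_congr_ae (ae_of_all _ fun x => ?_)
      simp only [inner_sub_left]
    rw [e2, Real.norm_eq_abs]
    exact hbd
  -- the majorant tends to `0` as `t → 0⁻`
  have hmaj : Tendsto (fun t : ℝ => Real.sqrt (M' * Real.sqrt (-t)) * I) (𝓝[<] 0) (𝓝 0) := by
    have hc : Continuous fun t : ℝ => Real.sqrt (M' * Real.sqrt (-t)) * I := by fun_prop
    have h0 : Real.sqrt (M' * Real.sqrt (-(0 : ℝ))) * I = 0 := by simp
    have h := hc.tendsto (0 : ℝ)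
    rw [h0] at h
    exact h.mono_left nhdsWithin_le_nhds
  rw [tendsto_iff_norm_sub_tendsto_zero]
  refine squeeze_zero' (Eventually.of_forall fun t => norm_nonneg _) ?_ hmaj
  filter_upwards [self_mem_nhdsWithin] with t ht
  exact hest t ht

/-! ### The ceiling from the envelope, and the two-sided apex energy law of the critical element -/

/-- **The envelope `‖u₀‖ ≤ A/‖x‖` gives `∫_{B(0,ρ)} ‖u₀‖² ≤ 3|B₁| A² ρ`** at every scale
(`∫_{B_ρ} ‖x‖⁻² = 3|B₁| ρ`). -/
theorem lintegral_ball_finalDatum_sq_le {A : ℝ}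
    {u₀ : EuclideanSpace ℝ (Fin 3) → EuclideanSpace ℝ (Fin 3)}
    (hu₀ : ∀ x : EuclideanSpace ℝ (Fin 3), x ≠ 0 → ‖u₀ x‖ ≤ A / ‖x‖) {ρ : ℝ} (hρ : 0 < ρ) :
    ∫⁻ x in ball (0 : EuclideanSpace ℝ (Fin 3)) ρ, ‖u₀ x‖ₑ ^ 2 ≤
      ENNReal.ofReal (3 * (volume : Measure (EuclideanSpace ℝ (Fin 3))).real (ball 0 1) * A ^ 2 * ρ) := by
  have hne : ∀ᵐ x ∂(volume : Measure (EuclideanSpace ℝ (Fin 3))), x ≠ 0 := by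
    rw [ae_iff]
    have e : {x : EuclideanSpace ℝ (Fin 3) | ¬ x ≠ 0} = {0} := by ext x; simp
    rw [e]; exact measure_singleton 0
  have hpt : ∀ x : EuclideanSpace ℝ (Fin 3), x ≠ 0 →
      ‖u₀ x‖ₑ ^ 2 ≤ ENNReal.ofReal (A ^ 2) * ENNReal.ofReal (‖x‖ ^ (-(2 : ℝ))) := by
    intro x hx
    have hxpos : 0 < ‖x‖ := norm_pos_iff.2 hx
    have hA : 0 ≤ A := by
      have h := (norm_nonneg _).trans (hu₀ x hx)
      exact (div_nonneg_iff.1 h).elim (fun h' => h'.1) fun h' => absurd h'.2 (not_le.2 hxpos)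
    have e : ‖x‖ ^ (-(2 : ℝ)) = (‖x‖ ^ 2)⁻¹ := by rw [Real.rpow_neg hxpos.le, Real.rpow_two]
    have h2 : ‖u₀ x‖ ^ 2 ≤ A ^ 2 * ‖x‖ ^ (-(2 : ℝ)) := by
      rw [e]
      calc ‖u₀ x‖ ^ 2 ≤ (A / ‖x‖) ^ 2 := pow_le_pow_left₀ (norm_nonneg _) (hu₀ x hx) 2
        _ = A ^ 2 * (‖x‖ ^ 2)⁻¹ := by field_simp
    calc ‖u₀ x‖ₑ ^ 2 = ENNReal.ofReal (‖u₀ x‖ ^ 2) := by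
          rw [← ofReal_norm, ENNReal.ofReal_pow (norm_nonneg _)]
      _ ≤ ENNReal.ofReal (A ^ 2 * ‖x‖ ^ (-(2 : ℝ))) := ENNReal.ofReal_le_ofReal h2
      _ = _ := ENNReal.ofReal_mul (by positivity)
  calc ∫⁻ x in ball (0 : EuclideanSpace ℝ (Fin 3)) ρ, ‖u₀ x‖ₑ ^ 2
      ≤ ∫⁻ x in ball (0 : EuclideanSpace ℝ (Fin 3)) ρ,
          ENNReal.ofReal (A ^ 2) * ENNReal.ofReal (‖x‖ ^ (-(2 : ℝ))) := by
        refine lintegral_mono_ae ?_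
        filter_upwards [ae_restrict_of_ae hne] with x hx
        exact hpt x hx
    _ = ENNReal.ofReal (A ^ 2) * ENNReal.ofReal (3 * (volume : Measure (EuclideanSpace ℝ (Fin 3))).real
          (ball 0 1) * (ρ ^ ((3 : ℝ) - 2) / (3 - 2))) := by
        rw [lintegral_const_mul' _ _ ENNReal.ofReal_ne_top,
          NewtonPotentialHolder.lintegral_ball_norm_rpow_neg (by norm_num) hρ]
    _ = ENNReal.ofReal (3 * (volume : Measure (EuclideanSpace ℝ (Fin 3))).real (ball 0 1) * A ^ 2 * ρ) := by
        rw [← ENNReal.ofReal_mul (by positivity)]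
        congr 1
        have e : ρ ^ ((3 : ℝ) - 2) = ρ := by norm_num
        rw [e]
        ring

/-- **THE FINAL DATUM OF THE CRITICAL ELEMENT: the trace across the apex, pinned to the Morrey
scaling from both sides.** For `K_c` minimal and `w ∈ 𝒟_{C,K_c}` singular there are the envelope
constant `A ≥ 0`, a floor `ε₀ = ε₀(C,K_c) > 0` and the final datum `u₀` (the `C¹` profile of
`…FinalDatumProfile`) such that: `‖u₀(x)‖ ≤ A/‖x‖`; the distributional trace of `w` is `u₀` for
EVERY test field (`∫⟪w(t), ψ⟫ → ∫⟪u₀, ψ⟫`); and at every scale `ρ > 0`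
`ε₀² ρ < ∫_{B(0,ρ)} ‖u₀‖² ≤ 3|B₁| A² ρ`. Portrait clause of skeleton v17 of line `birth`.
[cite: KochNadirashviliSereginSverak2009, §4 (arXiv:0709.3599 p. 8)] -/
theorem finalDatum_energy_apex_of_minimal {C Kc : ℝ}
    (hmin : ∀ K' : ℝ, K' < Kc → ∀ v : ℝ → EuclideanSpace ℝ (Fin 3) → EuclideanSpace ℝ (Fin 3),
      IsTypeIAncientMild C v →
      (∀ s : ℝ, s < 0 → ∫⁻ x, ‖fderiv ℝ (v s) x‖ₑ ^ 2 ≤ ENNReal.ofReal (K' / Real.sqrt (-s))) →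
      ¬ (∀ r > 0, ∀ M : ℝ, ∃ t ∈ Set.Ioo (-(r ^ 2)) (0 : ℝ),
        ∃ x ∈ Metric.ball (0 : EuclideanSpace ℝ (Fin 3)) r, M < ‖v t x‖))
    {w : ℝ → EuclideanSpace ℝ (Fin 3) → EuclideanSpace ℝ (Fin 3)} (hw : IsTypeIAncientMild C w)
    (hDw : ∀ s : ℝ, s < 0 → ∫⁻ x, ‖fderiv ℝ (w s) x‖ₑ ^ 2 ≤ ENNReal.ofReal (Kc / Real.sqrt (-s)))
    (hsw : ∀ r > 0, ∀ M : ℝ, ∃ t ∈ Set.Ioo (-(r ^ 2)) (0 : ℝ),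
      ∃ x ∈ Metric.ball (0 : EuclideanSpace ℝ (Fin 3)) r, M < ‖w t x‖) :
    ∃ (A ε₀ : ℝ) (u₀ : EuclideanSpace ℝ (Fin 3) → EuclideanSpace ℝ (Fin 3)),
      0 ≤ A ∧ 0 < ε₀ ∧
      (∀ x : EuclideanSpace ℝ (Fin 3), x ≠ 0 → ‖u₀ x‖ ≤ A / ‖x‖) ∧
      (∀ ψ : EuclideanSpace ℝ (Fin 3) → EuclideanSpace ℝ (Fin 3),
        FunctionSpaces.IsTestFunctionOn (⊤ : Opens (EuclideanSpace ℝ (Fin 3))) ψ →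
        Tendsto (fun t => ∫ x, ⟪w t x, ψ x⟫) (𝓝[<] 0) (𝓝 (∫ x, ⟪u₀ x, ψ x⟫))) ∧
      (∀ ρ > 0, ENNReal.ofReal (ε₀ ^ 2 * ρ) <
        ∫⁻ x in ball (0 : EuclideanSpace ℝ (Fin 3)) ρ, ‖u₀ x‖ₑ ^ 2) ∧
      (∀ ρ > 0, ∫⁻ x in ball (0 : EuclideanSpace ℝ (Fin 3)) ρ, ‖u₀ x‖ₑ ^ 2 ≤
        ENNReal.ofReal (3 * (volume : Measure (EuclideanSpace ℝ (Fin 3))).real (ball 0 1) *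
          A ^ 2 * ρ)) := by
  obtain ⟨A, L₀, M, u₀, hA0, -, -, -, hrate, henv, -, hener, -⟩ :=
    EnergyRemainder.finalDatum_profile_energy_of_minimal hmin hw hDw hsw
  have hu₀m : AEStronglyMeasurable u₀ (volume : Measure (EuclideanSpace ℝ (Fin 3))) :=
    EnergyRemainder.aestronglyMeasurable_finalDatum hw hrate
  have htrace : ∀ ψ : EuclideanSpace ℝ (Fin 3) → EuclideanSpace ℝ (Fin 3),
      FunctionSpaces.IsTestFunctionOn (⊤ : Opens (EuclideanSpace ℝ (Fin 3))) ψ →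
      Tendsto (fun t => ∫ x, ⟪w t x, ψ x⟫) (𝓝[<] 0) (𝓝 (∫ x, ⟪u₀ x, ψ x⟫)) :=
    fun ψ hψ => tendsto_pairing_of_energy hw hu₀m hener hψ
  obtain ⟨ε₀, hε₀, hfloor⟩ := trace_energy_apex_floor_of_singular C Kc
  refine ⟨A, ε₀, u₀, hA0, hε₀, henv, htrace, fun ρ hρ => ?_,
    fun ρ hρ => lintegral_ball_finalDatum_sq_le henv hρ⟩
  -- ### the floor, transferred to the function `u₀`
  obtain ⟨ψ, T, hψ, hsupp, hT, hlt⟩ := hfloor w hw hDw hsw ρ hρ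
  have hTeq : T = ∫ x, ⟪u₀ x, ψ x⟫ := tendsto_nhds_unique hT (htrace ψ hψ)
  -- the pairing only sees `u₀` on the ball: use the truncated field `1_{B(0,ρ)} u₀`
  set f : EuclideanSpace ℝ (Fin 3) → EuclideanSpace ℝ (Fin 3) :=
    (ball (0 : EuclideanSpace ℝ (Fin 3)) ρ).indicator u₀ with hf
  have hfm : AEStronglyMeasurable f (volume : Measure (EuclideanSpace ℝ (Fin 3))) :=
    hu₀m.indicator measurableSet_ball
  have hfψ : ∀ x, ⟪f x, ψ x⟫ = ⟪u₀ x, ψ x⟫ := by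
    intro x
    by_cases hx : x ∈ ball (0 : EuclideanSpace ℝ (Fin 3)) ρ
    · rw [hf, indicator_of_mem hx]
    · have hψ0 : ψ x = 0 := by
        by_contra h
        exact hx (mem_ball_zero_iff.2 (hsupp x h))
      rw [hψ0, inner_zero_right, inner_zero_right]
  have hfsq : ∫⁻ x, ‖f x‖ₑ ^ 2 = ∫⁻ x in ball (0 : EuclideanSpace ℝ (Fin 3)) ρ, ‖u₀ x‖ₑ ^ 2 := by
    rw [← lintegral_indicator measurableSet_ball]
    refine lintegral_congr fun x => ?_
    by_cases hx : x ∈ ball (0 : EuclideanSpace ℝ (Fin 3)) ρ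
    · rw [hf, indicator_of_mem hx, indicator_of_mem hx]
    · rw [hf, indicator_of_notMem hx, indicator_of_notMem hx, enorm_zero, zero_pow two_ne_zero]
  -- the ball energy is finite (ceiling)
  have hceil := lintegral_ball_finalDatum_sq_le henv hρ
  set Eρ : ℝ := (∫⁻ x in ball (0 : EuclideanSpace ℝ (Fin 3)) ρ, ‖u₀ x‖ₑ ^ 2).toReal with hEρ
  have hfin : ∫⁻ x in ball (0 : EuclideanSpace ℝ (Fin 3)) ρ, ‖u₀ x‖ₑ ^ 2 ≠ ⊤ :=
    ne_top_of_le_ne_top ENNReal.ofReal_ne_top hceil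
  have hEρ0 : 0 ≤ Eρ := ENNReal.toReal_nonneg
  have hEle : ∫⁻ x, ‖f x‖ₑ ^ 2 ≤ ENNReal.ofReal Eρ := by
    rw [hfsq, hEρ, ENNReal.ofReal_toReal hfin]
  obtain ⟨-, hbd⟩ := abs_integral_inner_le_of_lintegral_sq_le hfm hEρ0 hEle hψ
  have hbd' : |T| ≤ Real.sqrt Eρ * Real.sqrt (∫ x, ‖ψ x‖ ^ 2) := by
    rw [hTeq]
    have e : (∫ x, ⟪u₀ x, ψ x⟫) = ∫ x, ⟪f x, ψ x⟫ :=
      integral_congr_ae (ae_of_all _ fun x => (hfψ x).symm)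
    rw [e]
    exact hbd
  -- `ε₀ √ρ √I < √Eρ √I`, hence `√I > 0` and `ε₀ √ρ < √Eρ`
  set I : ℝ := Real.sqrt (∫ x, ‖ψ x‖ ^ 2) with hI
  have hI0 : 0 ≤ I := Real.sqrt_nonneg _
  have hchain : ε₀ * Real.sqrt ρ * I < Real.sqrt Eρ * I := lt_of_lt_of_le hlt hbd'
  have hIpos : 0 < I := by
    rcases hI0.lt_or_eq with h | h
    · exact h
    · rw [← h, mul_zero, mul_zero] at hchain
      exact absurd hchain (lt_irrefl _)
  have hkey : ε₀ * Real.sqrt ρ < Real.sqrt Eρ := lt_of_mul_lt_mul_right hchain hI0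
  have hsq : ε₀ ^ 2 * ρ < Eρ := by
    have h1 : 0 ≤ ε₀ * Real.sqrt ρ := by positivity
    have h2 := mul_self_lt_mul_self h1 hkey
    rw [Real.mul_self_sqrt hEρ0] at h2
    calc ε₀ ^ 2 * ρ = ε₀ * Real.sqrt ρ * (ε₀ * Real.sqrt ρ) := by
          rw [mul_mul_mul_comm, Real.mul_self_sqrt hρ.le]; ring
      _ < Eρ := h2
  rw [← ENNReal.ofReal_toReal hfin, ← hEρ]
  exact (ENNReal.ofReal_lt_ofReal_iff (lt_of_le_of_lt (by positivity) hsq)).2 hsq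

/-! ### Appended (lead g9): the apex energy floor for ANY representative of the trace -/

/-- **Apex energy floor of the final datum, for any function representing the trace.** For all
`C, K` there is `ε₀ = ε₀(C,K) > 0` such that: if `w` is a SINGULAR member of `𝒟_{C,K}` and `u₀`
is a measurable field which IS the distributional trace of `w` for every test field
(`∫⟪w(t), ψ⟫ → ∫⟪u₀, ψ⟫`, as supplied by `tendsto_pairing_of_energy`), then for every `ρ > 0`
with `∫_{B(0,ρ)} ‖u₀‖² < ∞` one has `ε₀² ρ < ∫_{B(0,ρ)} ‖u₀‖²` (the floor of
`trace_energy_apex_floor_of_singular`, transferred to the function by Cauchy–Schwarz on the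
ball). Used by the skeleton of line `birth` (v17) for the `u₀` of `…EnergyRemainder`.
[cite: KochNadirashviliSereginSverak2009, §4 (arXiv:0709.3599 p. 8)] -/
theorem lintegral_ball_finalDatum_sq_floor (C K : ℝ) : ∃ ε₀ > 0,
    ∀ (w : ℝ → EuclideanSpace ℝ (Fin 3) → EuclideanSpace ℝ (Fin 3)),
      IsTypeIAncientMild C w →
      (∀ s : ℝ, s < 0 → ∫⁻ x, ‖fderiv ℝ (w s) x‖ₑ ^ 2 ≤ ENNReal.ofReal (K / Real.sqrt (-s))) →
      (∀ r > 0, ∀ M : ℝ, ∃ t ∈ Set.Ioo (-(r ^ 2)) (0 : ℝ),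
          ∃ x ∈ Metric.ball (0 : EuclideanSpace ℝ (Fin 3)) r, M < ‖w t x‖) →
      ∀ (u₀ : EuclideanSpace ℝ (Fin 3) → EuclideanSpace ℝ (Fin 3)),
        AEStronglyMeasurable u₀ (volume : Measure (EuclideanSpace ℝ (Fin 3))) →
        (∀ ψ : EuclideanSpace ℝ (Fin 3) → EuclideanSpace ℝ (Fin 3),
          FunctionSpaces.IsTestFunctionOn (⊤ : Opens (EuclideanSpace ℝ (Fin 3))) ψ →
          Tendsto (fun t => ∫ x, ⟪w t x, ψ x⟫) (𝓝[<] 0) (𝓝 (∫ x, ⟪u₀ x, ψ x⟫))) →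
        ∀ ρ > 0, ∫⁻ x in ball (0 : EuclideanSpace ℝ (Fin 3)) ρ, ‖u₀ x‖ₑ ^ 2 ≠ ⊤ →
          ENNReal.ofReal (ε₀ ^ 2 * ρ) < ∫⁻ x in ball (0 : EuclideanSpace ℝ (Fin 3)) ρ, ‖u₀ x‖ₑ ^ 2 := by
  obtain ⟨ε₀, hε₀, hfloor⟩ := trace_energy_apex_floor_of_singular C K
  refine ⟨ε₀, hε₀, fun w hw hDw hsw u₀ hu₀m htrace ρ hρ hfin => ?_⟩
  obtain ⟨ψ, T, hψ, hsupp, hT, hlt⟩ := hfloor w hw hDw hsw ρ hρ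
  have hTeq : T = ∫ x, ⟪u₀ x, ψ x⟫ := tendsto_nhds_unique hT (htrace ψ hψ)
  set f : EuclideanSpace ℝ (Fin 3) → EuclideanSpace ℝ (Fin 3) :=
    (ball (0 : EuclideanSpace ℝ (Fin 3)) ρ).indicator u₀ with hf
  have hfm : AEStronglyMeasurable f (volume : Measure (EuclideanSpace ℝ (Fin 3))) :=
    hu₀m.indicator measurableSet_ball
  have hfψ : ∀ x, ⟪f x, ψ x⟫ = ⟪u₀ x, ψ x⟫ := by
    intro x
    by_cases hx : x ∈ ball (0 : EuclideanSpace ℝ (Fin 3)) ρ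
    · rw [hf, indicator_of_mem hx]
    · have hψ0 : ψ x = 0 := by
        by_contra h
        exact hx (mem_ball_zero_iff.2 (hsupp x h))
      rw [hψ0, inner_zero_right, inner_zero_right]
  have hfsq : ∫⁻ x, ‖f x‖ₑ ^ 2 = ∫⁻ x in ball (0 : EuclideanSpace ℝ (Fin 3)) ρ, ‖u₀ x‖ₑ ^ 2 := by
    rw [← lintegral_indicator measurableSet_ball]
    refine lintegral_congr fun x => ?_
    by_cases hx : x ∈ ball (0 : EuclideanSpace ℝ (Fin 3)) ρ
    · rw [hf, indicator_of_mem hx, indicator_of_mem hx]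
    · rw [hf, indicator_of_notMem hx, indicator_of_notMem hx, enorm_zero, zero_pow two_ne_zero]
  set Eρ : ℝ := (∫⁻ x in ball (0 : EuclideanSpace ℝ (Fin 3)) ρ, ‖u₀ x‖ₑ ^ 2).toReal with hEρ
  have hEρ0 : 0 ≤ Eρ := ENNReal.toReal_nonneg
  have hEle : ∫⁻ x, ‖f x‖ₑ ^ 2 ≤ ENNReal.ofReal Eρ := by
    rw [hfsq, hEρ, ENNReal.ofReal_toReal hfin]
  obtain ⟨-, hbd⟩ := abs_integral_inner_le_of_lintegral_sq_le hfm hEρ0 hEle hψ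
  have hbd' : |T| ≤ Real.sqrt Eρ * Real.sqrt (∫ x, ‖ψ x‖ ^ 2) := by
    rw [hTeq]
    have e : (∫ x, ⟪u₀ x, ψ x⟫) = ∫ x, ⟪f x, ψ x⟫ :=
      integral_congr_ae (ae_of_all _ fun x => (hfψ x).symm)
    rw [e]
    exact hbd
  set I : ℝ := Real.sqrt (∫ x, ‖ψ x‖ ^ 2) with hI
  have hI0 : 0 ≤ I := Real.sqrt_nonneg _
  have hchain : ε₀ * Real.sqrt ρ * I < Real.sqrt Eρ * I := lt_of_lt_of_le hlt hbd'
  have hkey : ε₀ * Real.sqrt ρ < Real.sqrt Eρ := lt_of_mul_lt_mul_right hchain hI0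
  have hsq : ε₀ ^ 2 * ρ < Eρ := by
    have h1 : 0 ≤ ε₀ * Real.sqrt ρ := by positivity
    have h2 := mul_self_lt_mul_self h1 hkey
    rw [Real.mul_self_sqrt hEρ0] at h2
    calc ε₀ ^ 2 * ρ = ε₀ * Real.sqrt ρ * (ε₀ * Real.sqrt ρ) := by
          rw [mul_mul_mul_comm, Real.mul_self_sqrt hρ.le]; ring
      _ < Eρ := h2
  rw [← ENNReal.ofReal_toReal hfin, ← hEρ]
  exact (ENNReal.ofReal_lt_ofReal_iff (lt_of_le_of_lt (by positivity) hsq)).2 hsq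

end Summit.NavierStokesRegularity.NavierStokesRegularity.Theorems.FiniteDissipationLiouville.EnergyTrace

end
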